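import Summits.BirchSwinnertonDyer.BirchSwinnertonDyer.Theses.ShadowIsolation
import Literature.NumberTheory.EllipticCurves.X1ElevenMordellWeil
import Literature.NumberTheory.EllipticCurves.MazurTorsionGaloisStructureProofs
import Literature.NumberTheory.EllipticCurves.RationalIsogenyFrobeniusCriterion
import Literature.NumberTheory.EllipticCurves.PointCountEulerCriterion

/-!
# Crux `ShaCotorsionReducible` (stmt-BirchSwinnertonDyer-15277): a sector member of positive rank —
# the strengthening "`Sel_{p^∞}` is cotorsion on the Eisenstein sector" is FALSE

Negative-side support for `R = Summit.BirchSwinnertonDyer.BirchSwinnertonDyer.Theses.ShadowIsolation.ShaCotorsionReducible`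
(crux disprover, cycle 1, 2026-08-17; record `Cruxes/ShaCotorsionReducible/Disproof.lean` §5).
The landed corank-`0` regime lemma `Theorems.shaCorank_eq_zero_of_selmerCorank_eq_zero` proves
instances of `R` from "`corank Sel_{p^∞}(E/ℚ) = 0`" (Kato at `r_an = 0`). This file shows in the kernel
that this regime does NOT cover the sector: the curve `E : y² + 4xy + 3y = x³ + 3x²` (`[4,3,3,0,0]`,
`Δ = -3⁵·41`, conductor `123`, the fibre `t = -3` of the universal `5`-torsion family over `X₁(5)`)
lies in the sector at `p = 5` (global minimal equation; good at `5`; `#Ẽ(𝔽₅) = 10`, `a₅ = -4`,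
ordinary; `(0,0)` has order `5`, so `E[5]` is reducible) AND has a rational point of infinite order,
`Q₀ = (-3/4, -9/8)`, certified by reduction theory alone (Silverman, *AEC* VII.2.1, VII.3.1): `Q₀`
lies in the kernel of reduction at `2` (`x ∉ ℤ₂`), which has no odd torsion, so no odd multiple of
`Q₀` vanishes; a non-zero `2`-power-torsion multiple would inject into `Ẽ(𝔽₁₁)`, of order
`#Ẽ(𝔽₁₁) = 15` (kernel point count). Hence `rank E(ℚ) ≥ 1`, `corank Sel_{5^∞}(E/ℚ) ≥ 1`
(Greenberg's identity), and `¬ (∀ sector, corank Sel_{p^∞} = 0)`.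

Theorems only (no definition, no named fact); nothing asserts a Theses statement.

## References
* J. H. Silverman, *The Arithmetic of Elliptic Curves*, 2nd ed. (2009): VII.2 Prop. 2.1, VII.3
  Prop. 3.1 (reduction of torsion), VIII (Mordell–Weil). [SilvermanAEC2009]
* D. Husemöller, *Elliptic Curves*, 2nd ed., Ch. 4 §4 (Tate normal form `E(b,b)` of `5`-torsion). [folklore]
* R. Greenberg, LNM 1716 (1999), §1 (`corank Sel_{p^∞} = rank + corank Ш[p^∞]`). [Greenberg1999LNM]
-/

set_option linter.dupNamespace false

noncomputable section

open scoped Classical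

namespace Summit.BirchSwinnertonDyer.BirchSwinnertonDyer.Theorems.ShaCotorsionReducible.Negative

open Literature.NumberTheory.EllipticCurves WeierstrassCurve

/-! ## Kernel point counts -/

/-- `#Ẽ(𝔽₅) = 10` (so `a₅ = -4`) for `[4, 3, 3, 0, 0]`. [folklore] -/
theorem card_int123_mod_five :
    Nat.card (((⟨4, 3, 3, 0, 0⟩ : WeierstrassCurve ℤ).map (Int.castRingHom (ZMod 5))).toAffine.Point)
      = 10 := by
  rw [@WeierstrassCurve.natCard_point_eq_one_add_card (ZMod 5) (@ZMod.instField 5 ⟨by norm_num⟩) _ _ _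
    (by decide +kernel), @card_sol_eq_sum_euler (ZMod 5) (@ZMod.instField 5 ⟨by norm_num⟩) _ _
    (by rw [ZMod.ringChar_zmod_n]; decide), ZMod.card]
  decide +kernel

/-- `#Ẽ(𝔽₁₁) = 15` for `[4, 3, 3, 0, 0]`. [folklore] -/
theorem card_int123_mod_eleven :
    Nat.card (((⟨4, 3, 3, 0, 0⟩ : WeierstrassCurve ℤ).map (Int.castRingHom (ZMod 11))).toAffine.Point)
      = 15 := by
  rw [@WeierstrassCurve.natCard_point_eq_one_add_card (ZMod 11) (@ZMod.instField 11 ⟨by norm_num⟩) _ _ _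
    (by decide +kernel), @card_sol_eq_sum_euler (ZMod 11) (@ZMod.instField 11 ⟨by norm_num⟩) _ _
    (by rw [ZMod.ringChar_zmod_n]; decide), ZMod.card]
  decide +kernel

/-! ## The `5`-torsion point `(0,0)` -/

/-- `(0,0)` is a nonsingular point of `E`. [folklore] -/
theorem nonsingular_origin_123 : (⟨4, 3, 3, 0, 0⟩ : WeierstrassCurve ℚ).toAffine.Nonsingular 0 0 :=
  (Affine.nonsingular_iff' _ _).mpr ⟨(Affine.equation_iff _ _).mpr (by norm_num), Or.inr (by norm_num)⟩

/-- `(-3, 9)` is a nonsingular point of `E`. [folklore] -/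
theorem nonsingular_P39 : (⟨4, 3, 3, 0, 0⟩ : WeierstrassCurve ℚ).toAffine.Nonsingular (-3) 9 :=
  (Affine.nonsingular_iff' _ _).mpr ⟨(Affine.equation_iff _ _).mpr (by norm_num), Or.inr (by norm_num)⟩

/-- `(0,0) + (0,0) = (-3, 9)` (tangent slope `0`). [folklore] -/
theorem T123_add_T123 [DecidableEq ℚ] :
    (Affine.Point.some 0 0 nonsingular_origin_123 : (⟨4, 3, 3, 0, 0⟩ : WeierstrassCurve ℚ).toAffine.Point)
      + Affine.Point.some 0 0 nonsingular_origin_123 = Affine.Point.some (-3) 9 nonsingular_P39 := by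
  have hy : (0 : ℚ) ≠ (⟨4, 3, 3, 0, 0⟩ : WeierstrassCurve ℚ).toAffine.negY 0 0 := by
    norm_num [Affine.negY]
  rw [Affine.Point.add_self_of_Y_ne hy]
  congr 1
  · rw [Affine.slope_of_Y_ne rfl hy]
    norm_num [Affine.addX, Affine.negY]
  · rw [Affine.slope_of_Y_ne rfl hy]
    norm_num [Affine.addY, Affine.negAddY, Affine.addX, Affine.negY]

/-- `(-3, 9) + (-3, 9) = (0, -3) = -(0,0)` (tangent slope `-3`). [folklore] -/
theorem P39_add_P39 [DecidableEq ℚ] :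
    (Affine.Point.some (-3) 9 nonsingular_P39 : (⟨4, 3, 3, 0, 0⟩ : WeierstrassCurve ℚ).toAffine.Point)
      + Affine.Point.some (-3) 9 nonsingular_P39 = -Affine.Point.some 0 0 nonsingular_origin_123 := by
  have hy : (9 : ℚ) ≠ (⟨4, 3, 3, 0, 0⟩ : WeierstrassCurve ℚ).toAffine.negY (-3) 9 := by
    norm_num [Affine.negY]
  rw [Affine.Point.add_self_of_Y_ne hy, Affine.Point.neg_some]
  congr 1
  · rw [Affine.slope_of_Y_ne rfl hy]
    norm_num [Affine.addX, Affine.negY]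
  · rw [Affine.slope_of_Y_ne rfl hy]
    norm_num [Affine.addY, Affine.negAddY, Affine.addX, Affine.negY]

/-- **`5 · (0,0) = O`** on `E = [4,3,3,0,0]`. [folklore] -/
theorem five_nsmul_T123 [DecidableEq ℚ] :
    (5 : ℕ) • (Affine.Point.some 0 0 nonsingular_origin_123 :
      (⟨4, 3, 3, 0, 0⟩ : WeierstrassCurve ℚ).toAffine.Point) = 0 := by
  rw [show (5 : ℕ) = 2 + 2 + 1 from rfl, add_nsmul, add_nsmul, two_nsmul, one_nsmul,
    T123_add_T123, P39_add_P39, neg_add_cancel]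

/-! ## Sector membership of `(E, 5)` -/

/-- **`([4,3,3,0,0], 5)` lies in the Eisenstein sector of the crux**: global minimal equation
(`p¹² ∤ Δ = -3⁵·41`, finite check), elliptic, good at `5`, `a₅ = 5 + 1 - 10 = -4` (ordinary), `E[5]`
reducible (`(0,0)` of order `5`, `not_hasIrreducibleModPGaloisRep_of_addOrderOf_eq`). [folklore] -/
theorem shaCotorsionReducible_sector_123 :
    ∃ (_ : ((⟨4, 3, 3, 0, 0⟩ : WeierstrassCurve ℤ).baseChange ℚ).IsElliptic)
      (_ : ((⟨4, 3, 3, 0, 0⟩ : WeierstrassCurve ℤ).baseChange ℚ).IsGloballyMinimal),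
      ((⟨4, 3, 3, 0, 0⟩ : WeierstrassCurve ℤ).baseChange ℚ).HasGoodReductionAtPrime 5 ∧
      ((⟨4, 3, 3, 0, 0⟩ : WeierstrassCurve ℤ).baseChange ℚ).frobeniusTrace 5 = -4 ∧
      ¬ (5 : ℤ) ∣ ((⟨4, 3, 3, 0, 0⟩ : WeierstrassCurve ℤ).baseChange ℚ).frobeniusTrace 5 ∧
      ¬ ((⟨4, 3, 3, 0, 0⟩ : WeierstrassCurve ℤ).baseChange ℚ).HasIrreducibleModPGaloisRep 5 := by
  set E₀ : WeierstrassCurve ℤ := ⟨4, 3, 3, 0, 0⟩ with hE₀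
  have hbc : E₀.baseChange ℚ = (⟨4, 3, 3, 0, 0⟩ : WeierstrassCurve ℚ) := by
    ext <;> simp [hE₀, WeierstrassCurve.baseChange, WeierstrassCurve.map]
  have hΔ : E₀.Δ = -9963 := by
    rw [hE₀]
    norm_num [WeierstrassCurve.Δ, WeierstrassCurve.b₂, WeierstrassCurve.b₄, WeierstrassCurve.b₆,
      WeierstrassCurve.b₈]
  haveI hE : (E₀.baseChange ℚ).IsElliptic := isElliptic_baseChange_int E₀ (by rw [hΔ]; decide)
  haveI hmin : (E₀.baseChange ℚ).IsGloballyMinimal :=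
    isGloballyMinimal_baseChange_int E₀ (forall_not_pow_dvd_or_of_bound E₀ (B := 3)
      (by rw [hE₀]; decide +kernel) (by rw [hΔ]; decide) (by rw [hE₀]; decide +kernel))
  have htr : (E₀.baseChange ℚ).frobeniusTrace 5 = -4 := by
    rw [frobeniusTrace_baseChange_int E₀ card_int123_mod_five]; norm_num
  refine ⟨hE, hmin, ?_, htr, by rw [htr]; decide, ?_⟩
  · exact hasGoodReductionAtPrime_baseChange_int E₀ 5 (by rw [hΔ]; decide)
  · haveI : (⟨4, 3, 3, 0, 0⟩ : WeierstrassCurve ℚ).IsElliptic := by rw [← hbc]; exact hE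
    rw [hbc]
    exact not_hasIrreducibleModPGaloisRep_of_addOrderOf_eq (⟨4, 3, 3, 0, 0⟩ : WeierstrassCurve ℚ)
      (addOrderOf_eq_prime five_nsmul_T123 (Affine.Point.some_ne_zero _))

/-! ## The point `Q₀ = (-3/4, -9/8)` of infinite order -/

/-- In `ZMod 2`: `4w + 3 = 1 ≠ 0`. [folklore] -/
theorem four_mul_add_three_ne_zero_zmod_two (w : ZMod 2) : 4 * w + 3 ≠ 0 := by
  revert w; decide

/-- `Q₀ = (-3/4, -9/8)` is a nonsingular point of `E`. [folklore] -/
theorem nonsingular_Q₀ : (⟨4, 3, 3, 0, 0⟩ : WeierstrassCurve ℚ).toAffine.Nonsingular (-3/4) (-9/8) :=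
  (Affine.nonsingular_iff' _ _).mpr ⟨(Affine.equation_iff _ _).mpr (by norm_num), Or.inr (by norm_num)⟩

/-- **No odd multiple of `Q₀` vanishes** (Silverman, *AEC* VII.3.1(a) at `p = 2`): `Q₀` maps to the
kernel of reduction `E₁(ℚ₂)` of the `ℤ₂`-integral equation `[4,3,3,0,0]` (`x = -3/4 ∉ ℤ₂`:
`4z = -3` is impossible modulo `2`), and `E₁(ℚ₂)` has no point of odd order
(`not_reducesToZero_of_zsmul_eq_zero`). [cite: SilvermanAEC2009, VII.3 Prop. 3.1(a)] -/
theorem odd_nsmul_Q₀_ne_zero {m : ℕ} (hm : Odd m) :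
    m • (Affine.Point.some (-3/4) (-9/8) nonsingular_Q₀ :
      (⟨4, 3, 3, 0, 0⟩ : WeierstrassCurve ℚ).toAffine.Point) ≠ 0 := by
  intro h0
  haveI : Fact (Nat.Prime 2) := ⟨Nat.prime_two⟩
  have hv := integers_valuationRing_valuation ℤ_[2] ℚ_[2]
  set W₀ : WeierstrassCurve ℤ_[2] := ⟨4, 3, 3, 0, 0⟩ with hW₀
  have hW : (⟨4, 3, 3, 0, 0⟩ : WeierstrassCurve ℚ).baseChange ℚ_[2] = W₀.baseChange ℚ_[2] := by
    rw [hW₀]; ext <;> simp [WeierstrassCurve.baseChange, WeierstrassCurve.map] <;> rfl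
  set ι : (⟨4, 3, 3, 0, 0⟩ : WeierstrassCurve ℚ).toAffine.Point →+ (W₀.baseChange ℚ_[2]).toAffine.Point :=
    (Affine.Point.congrEquiv hW).toAddMonoidHom.comp
      (Affine.Point.map (W' := (⟨4, 3, 3, 0, 0⟩ : WeierstrassCurve ℚ).toAffine) (S := ℚ)
        (Algebra.ofId ℚ ℚ_[2])) with hι
  -- the image of `Q₀` is the affine point with the same coordinates
  have e : ι (Affine.Point.some (-3/4) (-9/8) nonsingular_Q₀) =
      Affine.Point.congrEquiv hW (Affine.Point.map
        (W' := (⟨4, 3, 3, 0, 0⟩ : WeierstrassCurve ℚ).toAffine) (S := ℚ) (Algebra.ofId ℚ ℚ_[2])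
        (Affine.Point.some (-3/4) (-9/8) nonsingular_Q₀)) := rfl
  rw [Affine.Point.map_some, Affine.Point.congrEquiv_some] at e
  -- it reduces to `O`: `x = -3/4` is not a `2`-adic integer
  have hred : W₀.ReducesToZero (ι (Affine.Point.some (-3/4) (-9/8) nonsingular_Q₀)) := by
    rw [e, _root_.WeierstrassCurve.reducesToZero_some_iff]
    rintro ⟨z, hz⟩
    have hz' : (z : ℚ_[2]) = ((-3/4 : ℚ) : ℚ_[2]) := hz
    have h3 : ((4 * z + 3 : ℤ_[2]) : ℚ_[2]) = 0 := by
      have e3 : ((4 * z + 3 : ℤ_[2]) : ℚ_[2]) = 4 * (z : ℚ_[2]) + 3 := rfl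
      rw [e3, hz']; push_cast; norm_num
    have h4 : (4 : ℤ_[2]) * z + 3 = 0 := PadicInt.coe_eq_zero.mp h3
    have h5 := congrArg (PadicInt.toZMod (p := 2)) h4
    rw [map_add, map_mul, map_zero, map_ofNat, map_ofNat] at h5
    exact four_mul_add_three_ne_zero_zmod_two _ h5
  have hn : ValuationRing.valuation ℤ_[2] ℚ_[2] ((m : ℤ) : ℚ_[2]) = 1 :=
    X1Eleven.valuation_natCast_eq_one 2 fun h ↦ (Nat.not_even_iff_odd.2 hm) (even_iff_two_dvd.2 h)
  have hmP : (m : ℤ) • ι (Affine.Point.some (-3/4) (-9/8) nonsingular_Q₀) = 0 := by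
    rw [natCast_zsmul, ← map_nsmul, h0, map_zero]
  have hP0 : ι (Affine.Point.some (-3/4) (-9/8) nonsingular_Q₀) ≠ 0 := by
    rw [e]; exact Affine.Point.some_ne_zero _
  exact not_reducesToZero_of_zsmul_eq_zero hv hn hmP hP0 hred

/-- **`E(ℚ)` has no non-zero point killed by a power of `2`** (Silverman, *AEC* VII.3.1(b) at the good
prime `11`): such a point would inject into `Ẽ(𝔽₁₁)` (the kernel of reduction `E₁(ℚ₁₁)` has no
prime-to-`11` torsion), whose order is `#Ẽ(𝔽₁₁) = 15`, odd. [cite: SilvermanAEC2009, VII.3 Prop. 3.1(b)] -/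
theorem eq_zero_of_two_pow_nsmul_eq_zero_123
    (Q : (⟨4, 3, 3, 0, 0⟩ : WeierstrassCurve ℚ).toAffine.Point) (k : ℕ) (hQ : (2 ^ k : ℕ) • Q = 0) :
    Q = 0 := by
  by_contra hQ0
  haveI : Fact (Nat.Prime 11) := ⟨by norm_num⟩
  have hv := integers_valuationRing_valuation ℤ_[11] ℚ_[11]
  set W₀ : WeierstrassCurve ℤ_[11] := ⟨4, 3, 3, 0, 0⟩ with hW₀
  have hW : (⟨4, 3, 3, 0, 0⟩ : WeierstrassCurve ℚ).baseChange ℚ_[11] = W₀.baseChange ℚ_[11] := by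
    rw [hW₀]; ext <;> simp [WeierstrassCurve.baseChange, WeierstrassCurve.map] <;> rfl
  set ι : (⟨4, 3, 3, 0, 0⟩ : WeierstrassCurve ℚ).toAffine.Point →+ (W₀.baseChange ℚ_[11]).toAffine.Point :=
    (Affine.Point.congrEquiv hW).toAddMonoidHom.comp
      (Affine.Point.map (W' := (⟨4, 3, 3, 0, 0⟩ : WeierstrassCurve ℚ).toAffine) (S := ℚ)
        (Algebra.ofId ℚ ℚ_[11])) with hι
  have hιinj : Function.Injective ι :=
    (Affine.Point.congrEquiv hW).injective.comp
      (Affine.Point.map_injective (W' := (⟨4, 3, 3, 0, 0⟩ : WeierstrassCurve ℚ).toAffine)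
        (f := Algebra.ofId ℚ ℚ_[11]))
  set P := ι Q with hP
  have hP0 : P ≠ 0 := fun h ↦ hQ0 (hιinj (by rw [map_zero]; exact h))
  have hkP : ((2 ^ k : ℕ) : ℤ) • P = 0 := by rw [natCast_zsmul, hP, ← map_nsmul, hQ, map_zero]
  -- good reduction at `11`: unit discriminant
  have hΔ : IsUnit W₀.Δ := by
    have hΔ' : W₀.Δ = -9963 := by
      rw [hW₀]
      norm_num [WeierstrassCurve.Δ, WeierstrassCurve.b₂, WeierstrassCurve.b₄, WeierstrassCurve.b₆,
        WeierstrassCurve.b₈]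
    rw [hΔ', IsUnit.neg_iff, PadicInt.isUnit_iff]
    refine le_antisymm (PadicInt.norm_le_one _) (not_lt.mp fun hlt ↦ ?_)
    have h := (PadicInt.norm_int_lt_one_iff_dvd (p := 11) 9963).mp (by exact_mod_cast hlt)
    omega
  haveI : Finite (IsLocalRing.ResidueField ℤ_[11]) :=
    Finite.of_equiv (ZMod 11) (PadicInt.residueField (p := 11)).symm.toEquiv
  haveI : Fintype (IsLocalRing.ResidueField ℤ_[11]) := Fintype.ofFinite _
  haveI : Finite (W₀.map (IsLocalRing.residue ℤ_[11])).toAffine.Point := finite_point _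
  -- `v(2^k) = 1`
  have hn : ValuationRing.valuation ℤ_[11] ℚ_[11] (((2 ^ k : ℕ) : ℤ) : ℚ_[11]) = 1 :=
    X1Eleven.valuation_natCast_eq_one 11 fun h ↦ by
      have h2 : (11 : ℕ) ∣ 2 := (Nat.Prime.prime (by norm_num)).dvd_of_dvd_pow h
      omega
  -- `⟨P⟩ ↪ Ẽ(𝔽₁₁)`
  have hle : AddSubgroup.zmultiples P ≤ W₀.nonsingularReductionSubgroup hv :=
    AddSubgroup.zmultiples_le_of_mem (hasNonsingularReduction_of_isUnit_Δ hv hΔ P)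
  set f : AddSubgroup.zmultiples P →+ (W₀.map (IsLocalRing.residue ℤ_[11])).toAffine.Point :=
    (W₀.reductionHom hv).comp (AddSubgroup.inclusion hle) with hf_def
  have hf : Function.Injective f := by
    rw [injective_iff_map_eq_zero]
    rintro ⟨Q', hQ'⟩ hfQ
    obtain ⟨m, rfl⟩ := AddSubgroup.mem_zmultiples_iff.mp hQ'
    have hred : W₀.reducePoint (m • P) = 0 := hfQ
    have h0 : W₀.ReducesToZero (m • P) :=
      (_root_.WeierstrassCurve.reducePoint_eq_zero_iff hv (hle hQ')).mp hred
    have hk' : ((2 ^ k : ℕ) : ℤ) • (m • P) = 0 := by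
      rw [← mul_zsmul, mul_comm, mul_zsmul, hkP, zsmul_zero]
    by_contra hne
    exact not_reducesToZero_of_zsmul_eq_zero hv hn hk' (fun h ↦ hne (Subtype.ext h)) h0
  have hdvd : Nat.card (AddSubgroup.zmultiples P) ∣
      Nat.card (W₀.map (IsLocalRing.residue ℤ_[11])).toAffine.Point :=
    AddSubgroup.card_dvd_of_injective f hf
  -- `#Ẽ(𝔽₁₁) = 15`
  have hcard : Nat.card (W₀.map (IsLocalRing.residue ℤ_[11])).toAffine.Point = 15 := by
    have e1 : Nat.card ((W₀.map (IsLocalRing.residue ℤ_[11])).map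
        (PadicInt.residueField (p := 11) : IsLocalRing.ResidueField ℤ_[11] →+* ZMod 11)).toAffine.Point =
        Nat.card (W₀.map (IsLocalRing.residue ℤ_[11])).toAffine.Point :=
      natCard_point_map_ringEquiv _ _
    have key : (W₀.map (IsLocalRing.residue ℤ_[11])).map
        (PadicInt.residueField (p := 11) : IsLocalRing.ResidueField ℤ_[11] →+* ZMod 11) =
        (⟨4, 3, 3, 0, 0⟩ : WeierstrassCurve ℤ).map (Int.castRingHom (ZMod 11)) := by
      rw [hW₀]
      ext <;> simp [WeierstrassCurve.map] <;>
        first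
        | (rw [map_ofNat (IsLocalRing.residue ℤ_[11]) 4]; exact map_ofNat _ 4)
        | (rw [map_ofNat (IsLocalRing.residue ℤ_[11]) 3]; exact map_ofNat _ 3)
    rw [← e1, key]
    exact card_int123_mod_eleven
  -- the order of `P` is a power of `2`, `> 1`, and divides `15`
  have hordP : addOrderOf P ∣ 2 ^ k := by
    apply addOrderOf_dvd_of_nsmul_eq_zero
    rw [← natCast_zsmul]; exact hkP
  rw [Nat.card_zmultiples, hcard] at hdvd
  obtain ⟨j, -, hPj⟩ := (Nat.dvd_prime_pow Nat.prime_two).1 hordP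
  have hj : j ≠ 0 := by
    rintro rfl
    rw [pow_zero, AddMonoid.addOrderOf_eq_one_iff] at hPj
    exact hP0 hPj
  have h2 : 2 ∣ 15 := (dvd_pow_self 2 hj).trans (hPj ▸ hdvd)
  omega

/-- **`Q₀ = (-3/4, -9/8)` has infinite order in `E(ℚ)`**: write `n = 2ᵏ·m` with `m` odd; if
`m·Q₀ = O` use `odd_nsmul_Q₀_ne_zero`, else `m·Q₀` is a non-zero point killed by `2ᵏ`, excluded by
`eq_zero_of_two_pow_nsmul_eq_zero_123`. [cite: SilvermanAEC2009, VII.3 Prop. 3.1] -/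
theorem nsmul_Q₀_ne_zero {n : ℕ} (hn : 0 < n) :
    n • (Affine.Point.some (-3/4) (-9/8) nonsingular_Q₀ :
      (⟨4, 3, 3, 0, 0⟩ : WeierstrassCurve ℚ).toAffine.Point) ≠ 0 := by
  intro h
  obtain ⟨k, m, hm, rfl⟩ := Nat.exists_eq_two_pow_mul_odd hn.ne'
  rw [mul_comm, mul_nsmul] at h
  have hm0 := eq_zero_of_two_pow_nsmul_eq_zero_123 _ k h
  exact odd_nsmul_Q₀_ne_zero hm hm0

/-- A rational point of infinite order gives Mordell–Weil rank `≥ 1` (Mordell–Weil,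
`module_finite_point_holds`, makes `finrank` honest; the `DecidableEq ℚ` instance behind the group law
is a subsingleton, so the statement for the computable instance transports to the classical one used
by `WeierstrassCurve.mordellWeilRank`). [cite: SilvermanAEC2009, Thm. VIII.6.7] -/
theorem one_le_mordellWeilRank_of_nsmul_ne_zero (W : WeierstrassCurve ℚ) [W.IsElliptic]
    (Q : W.toAffine.Point) (hQ : ∀ n : ℕ, 0 < n → n • Q ≠ 0) : 1 ≤ W.mordellWeilRank := by
  have hQ' : ∀ [inst : DecidableEq ℚ] (n : ℕ), 0 < n → n • Q ≠ 0 := by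
    intro inst n hn
    have e : inst = instDecidableEqRat := Subsingleton.elim _ _
    subst e
    exact hQ n hn
  letI := Classical.decEq ℚ
  haveI : Module.Finite ℤ W.toAffine.Point := W.module_finite_point_holds
  have key : ∀ c : ℤ, c • Q = 0 → c = 0 := fun c hc ↦ by
    by_contra hc0
    have h1 : ((c.natAbs : ℕ) : ℤ) • Q = 0 := by
      rcases Int.natAbs_eq c with h | h
      · rw [← h]; exact hc
      · rw [show ((c.natAbs : ℕ) : ℤ) = -c by omega, neg_smul, hc, neg_zero]
    have h2 : c.natAbs • Q = 0 := by rw [natCast_zsmul] at h1; exact h1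
    exact hQ' c.natAbs (Int.natAbs_pos.mpr hc0) h2
  have hli : LinearIndependent ℤ ![Q] := by
    refine Fintype.linearIndependent_iff.mpr fun g hg i ↦ ?_
    rw [Fin.sum_univ_one, Matrix.cons_val_fin_one] at hg
    rw [Subsingleton.elim i 0]
    exact key (g 0) hg
  have := hli.fintype_card_le_finrank
  rw [Fintype.card_fin] at this
  unfold WeierstrassCurve.mordellWeilRank
  exact this

/-- **`rank E(ℚ) ≥ 1` for `E = [4,3,3,0,0]`.** [cite: SilvermanAEC2009, VII.3 Prop. 3.1 and Thm. VIII.6.7] -/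
theorem one_le_mordellWeilRank_123 :
    1 ≤ ((⟨4, 3, 3, 0, 0⟩ : WeierstrassCurve ℤ).baseChange ℚ).mordellWeilRank := by
  have hbc : (⟨4, 3, 3, 0, 0⟩ : WeierstrassCurve ℤ).baseChange ℚ = (⟨4, 3, 3, 0, 0⟩ : WeierstrassCurve ℚ) := by
    ext <;> simp [WeierstrassCurve.baseChange, WeierstrassCurve.map]
  rw [hbc]
  haveI : (⟨4, 3, 3, 0, 0⟩ : WeierstrassCurve ℚ).IsElliptic := by
    rw [← hbc]; exact isElliptic_baseChange_int _ (by
      norm_num [WeierstrassCurve.Δ, WeierstrassCurve.b₂, WeierstrassCurve.b₄, WeierstrassCurve.b₆,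
        WeierstrassCurve.b₈])
  exact one_le_mordellWeilRank_of_nsmul_ne_zero _ _ fun n hn ↦ nsmul_Q₀_ne_zero hn

/-- **`corank Sel_{5^∞}(E/ℚ) ≥ 1` for the sector member `E = [4,3,3,0,0]`** (Greenberg's identity
`corank Sel_{p^∞} = rank + corank Ш[p^∞]`, tree theorem `selmerCorank_eq_mordellWeilRank_add_holds`).
[cite: Greenberg1999LNM, §1 pp. 54–57] -/
theorem one_le_selmerCorank_123 :
    1 ≤ ((⟨4, 3, 3, 0, 0⟩ : WeierstrassCurve ℤ).baseChange ℚ).selmerCorank 5 := by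
  obtain ⟨hE, -, -⟩ := shaCotorsionReducible_sector_123
  haveI := hE
  have hId := ((⟨4, 3, 3, 0, 0⟩ : WeierstrassCurve ℤ).baseChange ℚ).selmerCorank_eq_mordellWeilRank_add_holds 5
  have h1 := one_le_mordellWeilRank_123
  omega

/-- **The strengthening "`Sel_{p^∞}(E/ℚ)` is cotorsion on the Eisenstein sector" of
`ShaCotorsionReducible` is FALSE**, witness `([4,3,3,0,0], 5)`: the corank-`0` regime lemma
`Theorems.shaCorank_eq_zero_of_selmerCorank_eq_zero` cannot close the crux.
[cite: Greenberg1999LNM, §1 pp. 54–57] -/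
theorem shaCotorsionReducible_strengthening_selmerCotorsion_false :
    ¬ ∀ (W : WeierstrassCurve ℚ) [W.IsElliptic] [W.IsGloballyMinimal] (p : ℕ) [Fact p.Prime],
        5 ≤ p → W.HasGoodReductionAtPrime p → ¬ (p : ℤ) ∣ W.frobeniusTrace p →
        ¬ W.HasIrreducibleModPGaloisRep p → W.selmerCorank p = 0 := by
  intro h
  obtain ⟨hE, hmin, hgood, -, hord, hred⟩ := shaCotorsionReducible_sector_123
  have h0 := h _ 5 le_rfl hgood hord hred
  have h1 := one_le_selmerCorank_123
  omega

end Summit.BirchSwinnertonDyer.BirchSwinnertonDyer.Theorems.ShaCotorsionReducible.Negative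

end
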